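import Mathlib
import Literature.Analysis.Complex.LaplaceHalfLine
import Summits.AnomalousDissipation.AnomalousDissipation.Theorems.SoloBlindWeightedMassBound
import Summits.AnomalousDissipation.AnomalousDissipation.Theorems.SoloBlindShiftedLineMass
import Summits.AnomalousDissipation.AnomalousDissipation.Theorems.SoloBlindHardyFromDecay
import Summits.AnomalousDissipation.AnomalousDissipation.Theorems.SoloBlindAprimeAssembly

/-!
# Solo-blind kernel #279 — [A′] TOTAL: integrability of the weighted mass and the model split

ENGINE-L-SPEC §13(a): `TOTAL = |A|·I1 + √(Q0′/(2γ₂))` bounds the weighted `L¹` mass of the read-out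
kernel `k_V`, where `R = k̂_V − A·(model)` is the function certified on the shifted line (#266/#273)
and `I1` bounds the weighted mass of the model kernel.  Two things were missing in the typed chain:
(1) the INTEGRABILITY of `‖k‖e^{γε t}` on `(0,∞)` (kernels #261/#266/#273 state the inequality only;
here it is exported: `integrableOn_weighted_of_sq` — AM–GM domination by the `L²` datum — and
`integrableOn_Aprime_mass` / `integrableOn_Aprime_mass_of_plain` under exactly the hypotheses of
#266 `Aprime_mass_le` / #273 `Aprime_mass_le_of_plain`);
(2) the SPLIT `k_V = k_R + A k_M` (`total_mass_le`): `∫‖k_V‖e^{γε t} ≤ X + ‖A‖·I1` with integrability.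
-/

namespace Summit.AnomalousDissipation.SoloBlind.AprimeTotal

open MeasureTheory Set Complex Literature.Analysis.Complex
open Summit.AnomalousDissipation.SoloBlind.WeightedMassBound
open Summit.AnomalousDissipation.SoloBlind.ResolventReadout
open scoped Real

/-- **Integrability from the `L²` datum** (AM–GM domination): `f ≥ 0` measurable with
`f² e^{2(a+γ₂)t}` integrable on `(0,∞)` (`γ₂ > 0`) ⇒ `f e^{at}` integrable on `(0,∞)`. -/
theorem integrableOn_weighted_of_sq {f : ℝ → ℝ} {a γ₂ : ℝ} (hγ : 0 < γ₂) (hf : ∀ t, 0 ≤ f t)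
    (hfm : AEStronglyMeasurable (fun t => f t * Real.exp (a * t)) (volume.restrict (Ioi 0)))
    (hQi : IntegrableOn (fun t => f t ^ 2 * Real.exp (2 * (a + γ₂) * t)) (Ioi 0)) :
    IntegrableOn (fun t => f t * Real.exp (a * t)) (Ioi 0) := by
  have hdom : IntegrableOn (fun t => (1 / 2) * (f t ^ 2 * Real.exp (2 * (a + γ₂) * t))
      + Real.exp (-(2 * γ₂) * t) / (2 * 1)) (Ioi 0) :=
    (hQi.const_mul (1 / 2)).add ((integrableOn_exp_neg_two_mul_Ioi hγ).div_const (2 * 1))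
  refine Integrable.mono' hdom hfm (Filter.Eventually.of_forall fun t => ?_)
  rw [Real.norm_of_nonneg (mul_nonneg (hf t) (Real.exp_pos _).le)]
  -- AM–GM with parameter l = 1 (as in #261)
  have h1 := mul_le_param_sq (f t * Real.exp ((a + γ₂) * t)) (Real.exp (-γ₂ * t)) one_pos
  have e0 : f t * Real.exp ((a + γ₂) * t) * Real.exp (-γ₂ * t) = f t * Real.exp (a * t) := by
    rw [mul_assoc, ← Real.exp_add]; congr 2; ring
  have e1 : (f t * Real.exp ((a + γ₂) * t)) ^ 2 = f t ^ 2 * Real.exp (2 * (a + γ₂) * t) := by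
    rw [mul_pow, ← Real.exp_nat_mul]; congr 2; push_cast; ring
  have e2 : Real.exp (-γ₂ * t) ^ 2 = Real.exp (-(2 * γ₂) * t) := by
    rw [← Real.exp_nat_mul]; congr 1; push_cast; ring
  rw [e0, e1, e2] at h1
  linarith

/-- **Integrability of the [A′] mass** under the hypotheses of #266 `Aprime_mass_le`. -/
theorem integrableOn_Aprime_mass {k : ℝ → ℂ} {F : ℂ → ℂ} {K γ M a : ℝ}
    (hk : HalfLineExpBound k K γ) (hM : 0 ≤ M)
    (hF : DifferentiableOn ℂ F {s : ℂ | a < s.re})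
    (hI : ∀ σ : ℝ, a < σ → Integrable (fun y : ℝ => ‖F (σ + y * I)‖ ^ 2))
    (hB : ∀ σ : ℝ, a < σ → ∫ y : ℝ, ‖F (σ + y * I)‖ ^ 2 ≤ M ^ 2)
    (hFk : ∀ s : ℂ, γ < s.re → a < s.re → F s = laplaceC k s)
    {γε γ₂ : ℝ} (hγ₂ : 0 < γ₂) (ha : a < -(γε + γ₂)) :
    IntegrableOn (fun t => ‖k t‖ * Real.exp (γε * t)) (Ioi 0) := by
  obtain ⟨hi, -⟩ := ShiftedLineMass.line_identity hk hM hF hI hB hFk ha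
  have e : ∀ t : ℝ, -(2 * -(γε + γ₂)) * t = 2 * (γε + γ₂) * t := fun t => by ring
  simp_rw [e] at hi
  have hmeas : AEStronglyMeasurable (fun t => ‖k t‖ * Real.exp (γε * t)) (volume.restrict (Ioi 0)) :=
    (hk.continuous.norm.mul (Real.continuous_exp.comp (continuous_const.mul continuous_id))).aestronglyMeasurable
  exact integrableOn_weighted_of_sq hγ₂ (fun t => norm_nonneg _) hmeas hi

/-- **Integrability of the [A′] mass** under the hypotheses of #273 `Aprime_mass_le_of_plain`. -/
theorem integrableOn_Aprime_mass_of_plain {A : Type*} [NormedRing A] [NormedAlgebra ℂ A]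
    [CompleteSpace A] [NormOneClass A] {L src : ℂ → A} (ℓ : A →L[ℂ] ℂ) {k : ℝ → ℂ}
    {K γ a b q C₀ : ℝ} (hk : HalfLineExpBound k K γ) (hγb : γ < b)
    (hL : DifferentiableOn ℂ L {s : ℂ | a < s.re ∧ s.re < b})
    (hsrc : DifferentiableOn ℂ src {s : ℂ | a < s.re ∧ s.re < b}) (hq : q < 1)
    (hplain : ∀ σ y : ℝ, a < σ → σ ≤ b → ‖L (σ + y * I)‖ ≤ q)
    (hC₀ : ∀ σ y : ℝ, a < σ → σ ≤ b → ‖src (σ + y * I)‖ ≤ C₀ / Real.sqrt (1 + y ^ 2))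
    (hFk : ∀ s : ℂ, γ < s.re → a < s.re → readout L src ℓ s = laplaceC k s)
    {γε γ₂ : ℝ} (hγ₂ : 0 < γ₂) (ha : a < -(γε + γ₂)) :
    IntegrableOn (fun t => ‖k t‖ * Real.exp (γε * t)) (Ioi 0) := by
  obtain ⟨_, hBinv⟩ := strip_data_of_plain (A := A) hq hplain
  have hB0 : 0 ≤ (1 - q)⁻¹ := inv_nonneg.2 (by linarith)
  have hC := strip_envelope (src := src) ℓ hB0 hBinv hC₀
  have hF := AprimeAssembly.readout_differentiableOn_halfPlane ℓ hk hγb hL hsrc hq hplain hFk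
  obtain ⟨M, hM, hI, hB⟩ := HardyFromDecay.hardy_of_strip_decay hk hγb hF hFk hC
  exact integrableOn_Aprime_mass hk hM hF hI hB hFk hγ₂ ha

/-- **TOTAL** (the model split): if `k_R := k_V − A k_M` has weighted mass `≤ X` (from #266/#273 with
its integrability from `integrableOn_Aprime_mass*`) and the model kernel `k_M` has weighted mass `≤ I1`,
then `k_V` has integrable weighted mass `≤ X + ‖A‖ I1`. -/
theorem total_mass_le {kV kM : ℝ → ℂ} (hkV : Continuous kV) {A : ℂ} {γε X I1 : ℝ}
    (hR : IntegrableOn (fun t => ‖kV t - A * kM t‖ * Real.exp (γε * t)) (Ioi 0))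
    (hRle : ∫ t in Ioi (0 : ℝ), ‖kV t - A * kM t‖ * Real.exp (γε * t) ≤ X)
    (hM : IntegrableOn (fun t => ‖kM t‖ * Real.exp (γε * t)) (Ioi 0))
    (hMle : ∫ t in Ioi (0 : ℝ), ‖kM t‖ * Real.exp (γε * t) ≤ I1) :
    IntegrableOn (fun t => ‖kV t‖ * Real.exp (γε * t)) (Ioi 0) ∧
      ∫ t in Ioi (0 : ℝ), ‖kV t‖ * Real.exp (γε * t) ≤ X + ‖A‖ * I1 := by
  have hdom : IntegrableOn (fun t => ‖kV t - A * kM t‖ * Real.exp (γε * t)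
      + ‖A‖ * (‖kM t‖ * Real.exp (γε * t))) (Ioi 0) := hR.add (hM.const_mul ‖A‖)
  have hpt : ∀ t : ℝ, ‖kV t‖ * Real.exp (γε * t)
      ≤ ‖kV t - A * kM t‖ * Real.exp (γε * t) + ‖A‖ * (‖kM t‖ * Real.exp (γε * t)) := by
    intro t
    have hsplit : kV t = (kV t - A * kM t) + A * kM t := by ring
    have hn : ‖kV t‖ ≤ ‖kV t - A * kM t‖ + ‖A‖ * ‖kM t‖ := by
      calc ‖kV t‖ = ‖(kV t - A * kM t) + A * kM t‖ := by rw [← hsplit]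
        _ ≤ ‖kV t - A * kM t‖ + ‖A * kM t‖ := norm_add_le _ _
        _ = ‖kV t - A * kM t‖ + ‖A‖ * ‖kM t‖ := by rw [norm_mul]
    have hexp : 0 ≤ Real.exp (γε * t) := (Real.exp_pos _).le
    nlinarith
  have hmeas : AEStronglyMeasurable (fun t => ‖kV t‖ * Real.exp (γε * t)) (volume.restrict (Ioi 0)) :=
    (hkV.norm.mul (Real.continuous_exp.comp (continuous_const.mul continuous_id))).aestronglyMeasurable
  have hint : IntegrableOn (fun t => ‖kV t‖ * Real.exp (γε * t)) (Ioi 0) := by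
    refine Integrable.mono' hdom hmeas (Filter.Eventually.of_forall fun t => ?_)
    rw [Real.norm_of_nonneg (mul_nonneg (norm_nonneg _) (Real.exp_pos _).le)]
    exact hpt t
  refine ⟨hint, ?_⟩
  calc ∫ t in Ioi (0 : ℝ), ‖kV t‖ * Real.exp (γε * t)
      ≤ ∫ t in Ioi (0 : ℝ), (‖kV t - A * kM t‖ * Real.exp (γε * t)
          + ‖A‖ * (‖kM t‖ * Real.exp (γε * t))) :=
        integral_mono_of_nonneg (Filter.Eventually.of_forall fun t =>
          mul_nonneg (norm_nonneg _) (Real.exp_pos _).le) hdom (Filter.Eventually.of_forall hpt)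
    _ = (∫ t in Ioi (0 : ℝ), ‖kV t - A * kM t‖ * Real.exp (γε * t))
          + ‖A‖ * ∫ t in Ioi (0 : ℝ), ‖kM t‖ * Real.exp (γε * t) := by
        rw [integral_add hR (hM.const_mul ‖A‖), integral_const_mul]
    _ ≤ X + ‖A‖ * I1 := by gcongr

end Summit.AnomalousDissipation.SoloBlind.AprimeTotal
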